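import Mathlib.AlgebraicGeometry.EllipticCurve.DivisionPolynomial.Degree
import Mathlib.FieldTheory.IsAlgClosed.Basic
import Literature.NumberTheory.EllipticCurves.TateModuleProofs
import HarnessLib

/-!
# The `2`-power torsion and the `2`-adic Tate module of an elliptic curve, unconditionally

Trunk EllArithM / T-ELLARITH; serves the named facts `WeierstrassCurve.finrank_tateModule_eq_two` and
`WeierstrassCurve.finrank_rationalTateModule_eq_two` of
`Literature.NumberTheory.EllipticCurves.TateModule` (Silverman, *AEC*, Prop. III.7.1(a):
`T_ℓ(E) ≅ ℤ_ℓ × ℤ_ℓ` for `ℓ ≠ char K`) **at the prime `ℓ = 2`**, with a complete, sorry-free proof.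

For general `ℓ` the printed proof rests on Cor. III.6.4(b) (`#E[m] = m²`), i.e. on the theory of
isogenies or on the multiplication-by-`m` formula for division polynomials (Exercise 3.7(d)), neither
of which is in Mathlib at this pin; the reduction of III.7.1(a) to III.6.4(b) is proved in the sibling
files `TateModuleProofs` / `TateModuleRank`. For `ℓ = 2`, however, Silverman's Exercise 3.31(a)–(d)
points out that everything is elementary ("use explicit formulas to prove that the doubling map has
degree 4 … deduce that `#E[2ⁿ] = 4ⁿ` … conclude that `E[2ⁿ] ≅ ℤ/2ⁿℤ × ℤ/2ⁿℤ`"), and this file carries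
that programme out on top of Mathlib's group law:

1. `natCard_torsionBy_two`: over an algebraically closed field `K` with `2 ≠ 0`, `#E(K)[2] = 4`: the
   nonzero `2`-torsion points are the `(x, -(a₁x + a₃)/2)` with `x` a root of the `2`-division cubic
   `Ψ₂Sq = 4x³ + b₂x² + 2b₄x + b₆`, whose discriminant `16Δ ≠ 0` gives three distinct roots
   (Silverman, proof of Prop. III.4.2(a); Mathlib `twoTorsionPolynomial_discr`, `Cubic.*_three_roots`).
2. `two_nsmul_surjective_of_isAlgClosed`: `[2] : E(K) → E(K)` is onto. Given `Q = (c, d)`, the quartic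
   `Φ₂ - c·Ψ₂Sq` (`Φ₂ = x⁴ - b₄x² - 2b₆x - b₈`) has a root `x₀`; a point `P = (x₀, y₀)` above it is
   not `2`-torsion because `Φ₂` and `Ψ₂Sq` have no common root when `Δ ≠ 0` (Exercise 3.1; here:
   `Φ₂(r₁) = (r₁ - r₂)²(r₁ - r₃)²` at the roots `rᵢ` of `Ψ₂Sq`), and by the duplication formula
   III.2.3(d), `x([2]P) = Φ₂(x₀)/Ψ₂Sq(x₀) = c`, so `[2]P = ±Q`.
3. `Literature.NumberTheory.EllipticCurves.natCard_torsionBy_mul_of_nsmul_surjective`: for an abelian group on which `[n]` is onto,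
   `#A[mn] = #A[m]·#A[n]` (`[n] : A[mn] ↠ A[m]` has kernel `A[n]`); hence `#E(K)[2ᵏ] = 2^{2k}`
   (`natCard_torsionBy_two_pow`).
4. `card_geomTorsion_two_pow`, and via `Literature.NumberTheory.EllipticCurves.TateModule.finrank_eq_two_of_card_torsionBy` /
   `Literature.NumberTheory.EllipticCurves.RationalTateModule.finrank_eq_two_of_card_torsionBy` (file `TateModuleProofs`):
   `finrank_tateModule_eq_two W 2` and `finrank_rationalTateModule_eq_two W 2` hold
   (`finrank_tateModule_eq_two_holds_two`, `finrank_rationalTateModule_eq_two_holds_two`), together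
   with `Module.Free`/`Module.Finite` for `T_2 E` when `char F ≠ 2`.

## References

* J. H. Silverman, *The Arithmetic of Elliptic Curves*, 2nd ed., GTM 106, Springer 2009:
  Group Law Algorithm III.2.3(d) (duplication formula), proof of Prop. III.4.2(a), Exercise 3.1,
  Exercise 3.31(a)–(d), Prop. III.7.1(a). [SilvermanAEC2009]

## Design

* `noncomputable section`, `open scoped Classical`, one universe `u`, no `[DecidableEq]` variables
  (as in `GaloisAction`, `TwoTorsion`, `TateModule*`), so that the group law on
  `(W.baseChange F̄).toAffine.Point` is literally the one underlying `geomPoints W`.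
* Generic statements are proved for a Weierstrass curve `V` over any algebraically closed field `K`
  with `(2 : K) ≠ 0` (deliberate dot-notation extensions in `namespace WeierstrassCurve`); the
  group-theoretic counting lives in `namespace Literature`.
-/

noncomputable section

open scoped Classical
open scoped AddSubgroup Polynomial.Bivariate
open Polynomial

universe u

/-! ## Counting torsion in a divisible abelian group -/

namespace Literature.NumberTheory.EllipticCurves

variable {A : Type u} [AddCommGroup A]

/-- If multiplication by `n` is surjective on an abelian group `A`, then `#A[mn] = #A[m] · #A[n]`
(as `Nat.card`s): the map `[n] : A[mn] → A[m]` is onto with kernel `A[n]`. This is the counting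
step in Silverman, *AEC*, Exercise 3.31(b),(c) and in the proof of Prop. III.7.1. [folklore] -/
theorem natCard_torsionBy_mul_of_nsmul_surjective {m n : ℕ}
    (hn : Function.Surjective fun P : A => n • P) :
    Nat.card (A[(m * n : ℕ)]) = Nat.card (A[(m : ℕ)]) * Nat.card (A[(n : ℕ)]) := by
  let φ : A[(m * n : ℕ)] →+ A[(m : ℕ)] :=
    { toFun := fun P => ⟨n • (P : A), by
        apply AddSubgroup.torsionBy.nsmul_iff.mpr
        rw [← mul_smul]
        exact AddSubgroup.torsionBy.nsmul_iff.mp P.2⟩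
      map_zero' := Subtype.ext (smul_zero n)
      map_add' := fun P Q => Subtype.ext (smul_add n (P : A) Q) }
  have hφ : Function.Surjective φ := by
    rintro ⟨Q, hQ⟩
    obtain ⟨P, hP⟩ := hn Q
    refine ⟨⟨P, ?_⟩, Subtype.ext hP⟩
    apply AddSubgroup.torsionBy.nsmul_iff.mpr
    have hP' : n • P = Q := hP
    rw [mul_smul, hP']
    exact AddSubgroup.torsionBy.nsmul_iff.mp hQ
  have hker : Nat.card φ.ker = Nat.card (A[(n : ℕ)]) := by
    refine Nat.card_congr
      { toFun := fun P => ⟨((P : A[(m * n : ℕ)]) : A), ?_⟩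
        invFun := fun Q => ⟨⟨(Q : A), ?_⟩, ?_⟩
        left_inv := fun P => Subtype.ext (Subtype.ext rfl)
        right_inv := fun Q => Subtype.ext rfl }
    · apply AddSubgroup.torsionBy.nsmul_iff.mpr
      exact congrArg Subtype.val ((AddMonoidHom.mem_ker).mp P.2)
    · apply AddSubgroup.torsionBy.nsmul_iff.mpr
      rw [mul_smul, AddSubgroup.torsionBy.nsmul_iff.mp Q.2, smul_zero]
    · rw [AddMonoidHom.mem_ker]
      exact Subtype.ext (AddSubgroup.torsionBy.nsmul_iff.mp Q.2)
  calc Nat.card (A[(m * n : ℕ)]) = Nat.card φ.ker * φ.ker.index := (AddSubgroup.card_mul_index _).symm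
    _ = Nat.card (A[(n : ℕ)]) * Nat.card (A[(m : ℕ)]) := by
        rw [hker, AddSubgroup.index_ker, AddMonoidHom.range_eq_top_of_surjective _ hφ,
          AddSubgroup.card_top]
    _ = Nat.card (A[(m : ℕ)]) * Nat.card (A[(n : ℕ)]) := Nat.mul_comm _ _

/-- `#A[1] = 1`. [folklore] -/
theorem natCard_torsionBy_one : Nat.card (A[((1 : ℕ) : ℤ)]) = 1 := by
  have h0 : ∀ x : A[((1 : ℕ) : ℤ)], x = 0 := fun x =>
    Subtype.ext (by simpa using AddSubgroup.torsionBy.nsmul x)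
  haveI : Subsingleton (A[((1 : ℕ) : ℤ)]) := ⟨fun a b => by rw [h0 a, h0 b]⟩
  exact Nat.card_unique

/-- If multiplication by `q` is surjective on `A` and `#A[q] = c`, then `#A[qᵏ] = cᵏ` for all `k`
(induction on `k` with `natCard_torsionBy_mul_of_nsmul_surjective`). Silverman, *AEC*,
Exercise 3.31(b),(c) (for `q = 2`, `c = 4`). [folklore] -/
theorem natCard_torsionBy_pow_of_nsmul_surjective {q c : ℕ}
    (hq : Function.Surjective fun P : A => q • P) (h1 : Nat.card (A[(q : ℕ)]) = c) (k : ℕ) :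
    Nat.card (A[(q ^ k : ℕ)]) = c ^ k := by
  induction k with
  | zero => rw [pow_zero, pow_zero]; exact natCard_torsionBy_one
  | succ k ih => rw [pow_succ, natCard_torsionBy_mul_of_nsmul_surjective hq, ih, h1, pow_succ]

end Literature.NumberTheory.EllipticCurves

/-! ## Elliptic curves over an algebraically closed field of characteristic `≠ 2` -/

namespace WeierstrassCurve

variable {K : Type u} [Field K] (V : WeierstrassCurve K)

/-! ### Points above a given `x`-coordinate -/

/-- Over an algebraically closed field every `x₀` is the `x`-coordinate of an affine point of `V`
(the Weierstrass equation is monic quadratic in `y`). Silverman, *AEC*, III.§1. [folklore] -/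
theorem exists_equation_of_isAlgClosed [IsAlgClosed K] (x₀ : K) : ∃ y₀, V.toAffine.Equation x₀ y₀ := by
  set q : K[X] := V.toAffine.polynomial.map (evalRingHom x₀) with hq
  have hmon : q.Monic := Affine.monic_polynomial.map _
  have hdeg : q.degree ≠ 0 := by
    rw [degree_eq_natDegree hmon.ne_zero, hq, Affine.monic_polynomial.natDegree_map,
      Affine.natDegree_polynomial]
    simp
  obtain ⟨y₀, hy₀⟩ := IsAlgClosed.exists_root q hdeg
  refine ⟨y₀, ?_⟩
  change V.toAffine.polynomial.evalEval x₀ y₀ = 0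
  rw [← map_evalRingHom_eval]
  exact hy₀

/-- On the curve, `Ψ₂Sq(x) = ψ₂(x, y)² = (2y + a₁x + a₃)²`. Silverman, *AEC*, III.2.3(d) and
Exercise 3.7 (`ψ₂² = 4x³ + b₂x² + 2b₄x + b₆`). [folklore] -/
theorem eval_Ψ₂Sq_eq_sq {x y : K} (h : V.toAffine.Equation x y) :
    V.Ψ₂Sq.eval x = (2 * y + V.a₁ * x + V.a₃) ^ 2 := by
  have e := congrArg (Polynomial.evalEval x y) V.C_Ψ₂Sq
  rw [evalEval_C, evalEval_sub, evalEval_mul, evalEval_pow, ψ₂, Affine.evalEval_polynomialY,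
    show V.toAffine.polynomial.evalEval x y = 0 from h, mul_zero, sub_zero] at e
  exact e

/-! ### `2`-torsion points and the duplication formula -/

/-- An affine point `P = (x, y)` satisfies `2P = O` iff `P = -P`, i.e. iff `y = -y - a₁x - a₃`.
Silverman, *AEC*, Group Law Algorithm III.2.3(a),(b). [folklore] -/
theorem two_nsmul_some_eq_zero_iff_eq_negY {x y : K} (h : V.toAffine.Nonsingular x y) :
    (2 : ℕ) • (Affine.Point.some x y h : V.toAffine.Point) = 0 ↔ y = V.toAffine.negY x y := by
  rw [two_nsmul]
  refine ⟨fun h2 => ?_, fun hy => Affine.Point.add_self_of_Y_eq hy⟩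
  by_contra hy
  rw [Affine.Point.add_self_of_Y_ne hy] at h2
  exact Affine.Point.some_ne_zero _ h2

/-- An affine point `P = (x, y)` satisfies `2P = O` iff `x` is a root of the `2`-division cubic
`Ψ₂Sq = 4x³ + b₂x² + 2b₄x + b₆` (`= (2y + a₁x + a₃)²` on the curve). Silverman, *AEC*, proof of
Prop. III.4.2(a) ("if a point `P = (x, y) ∈ E` has order 2, then it must satisfy
`4x³ + b₂x² + 2b₄x + b₆ = 0`"). [folklore] -/
theorem two_nsmul_some_eq_zero_iff_isRoot_Ψ₂Sq {x y : K} (h : V.toAffine.Nonsingular x y) :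
    (2 : ℕ) • (Affine.Point.some x y h : V.toAffine.Point) = 0 ↔ V.Ψ₂Sq.IsRoot x := by
  rw [V.two_nsmul_some_eq_zero_iff_eq_negY h, IsRoot.def, V.eval_Ψ₂Sq_eq_sq h.left,
    pow_eq_zero_iff two_ne_zero, Affine.negY]
  constructor <;> intro h' <;> linear_combination h'

/-- **The duplication formula** (Silverman, *AEC*, Group Law Algorithm III.2.3(d)): for an affine
point `P = (x, y)` with `2P ≠ O`,
`x([2]P) = (x⁴ - b₄x² - 2b₆x - b₈) / (4x³ + b₂x² + 2b₄x + b₆) = Φ₂(x) / Ψ₂Sq(x)`; here with the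
denominator cleared, `x([2]P)` being Mathlib's `addX x x (slope x x y y)`.
[cite: SilvermanAEC2009, Group Law Algorithm III.2.3(d)] -/
theorem addX_self_mul_eval_Ψ₂Sq {x y : K} (h : V.toAffine.Equation x y)
    (hy : y ≠ V.toAffine.negY x y) :
    V.toAffine.addX x x (V.toAffine.slope x x y y) * V.Ψ₂Sq.eval x = (V.Φ 2).eval x := by
  have hD : 2 * y + V.a₁ * x + V.a₃ ≠ 0 := by
    intro h0; apply hy; rw [Affine.negY]; linear_combination h0
  rw [Affine.slope_of_Y_ne rfl hy, V.eval_Ψ₂Sq_eq_sq h, Φ_two]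
  rw [V.toAffine.equation_iff] at h
  have hden : y - V.toAffine.negY x y = 2 * y + V.a₁ * x + V.a₃ := by rw [Affine.negY]; ring
  rw [hden]
  set D := 2 * y + V.a₁ * x + V.a₃ with hDdef
  set N := 3 * x ^ 2 + 2 * V.toAffine.a₂ * x + V.toAffine.a₄ - V.toAffine.a₁ * y with hNdef
  have hL : V.toAffine.addX x x (N / D) * D ^ 2 = N ^ 2 + V.a₁ * N * D - (V.a₂ + 2 * x) * D ^ 2 := by
    rw [Affine.addX]
    field_simp
    ring
  rw [hL]
  simp only [eval_sub, eval_pow, eval_X, eval_mul, eval_C, b₄, b₆, b₈, hDdef, hNdef]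
  linear_combination (-(V.a₁ ^ 2 + 4 * V.a₂ + 8 * x)) * h

/-! ### The three roots of the `2`-division cubic -/

section TwoNeZero

variable [IsAlgClosed K] [V.IsElliptic]

/-- For an elliptic curve over an algebraically closed field with `2 ≠ 0`, the `2`-division cubic
`Ψ₂Sq = 4x³ + b₂x² + 2b₄x + b₆` has three distinct roots `r₁, r₂, r₃` (its discriminant is `16Δ ≠ 0`),
and `b₂ = -4(r₁ + r₂ + r₃)`, `2b₄ = 4(r₁r₂ + r₁r₃ + r₂r₃)`, `b₆ = -4r₁r₂r₃`.
Silverman, *AEC*, proof of Prop. III.4.2(a); Mathlib `twoTorsionPolynomial_discr`. [folklore] -/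
theorem exists_roots_Ψ₂Sq (h2 : (2 : K) ≠ 0) :
    ∃ r₁ r₂ r₃ : K, V.Ψ₂Sq.roots = {r₁, r₂, r₃} ∧ (r₁ ≠ r₂ ∧ r₁ ≠ r₃ ∧ r₂ ≠ r₃) ∧
      V.b₂ = 4 * -(r₁ + r₂ + r₃) ∧ 2 * V.b₄ = 4 * (r₁ * r₂ + r₁ * r₃ + r₂ * r₃) ∧
      V.b₆ = 4 * -(r₁ * r₂ * r₃) := by
  have h4 : (4 : K) ≠ 0 := by
    rw [show (4 : K) = 2 * 2 by norm_num]; exact mul_ne_zero h2 h2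
  have ha : V.twoTorsionPolynomial.a ≠ 0 := h4
  have hsplit : (V.twoTorsionPolynomial.toPoly.map (RingHom.id K)).Splits := IsAlgClosed.splits _
  have hdisc : V.twoTorsionPolynomial.discr ≠ 0 :=
    V.twoTorsionPolynomial_discr_ne_zero (isUnit_iff_ne_zero.mpr h2) V.isUnit_Δ
  obtain ⟨r₁, r₂, r₃, h3⟩ := (Cubic.splits_iff_roots_eq_three ha).mp hsplit
  have hne := (Cubic.discr_ne_zero_iff_roots_ne ha h3).mp hdisc
  have hb := Cubic.b_eq_three_roots ha h3
  have hc := Cubic.c_eq_three_roots ha h3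
  have hd := Cubic.d_eq_three_roots ha h3
  simp only [RingHom.id_apply, twoTorsionPolynomial] at hb hc hd
  refine ⟨r₁, r₂, r₃, ?_, hne, hb, hc, hd⟩
  rw [Cubic.map_roots, Polynomial.map_id, ← Ψ₂Sq_eq] at h3
  exact h3

/-- `Ψ₂Sq` has exactly three distinct roots over an algebraically closed field with `2 ≠ 0`.
Silverman, *AEC*, proof of Prop. III.4.2(a). [folklore] -/
theorem card_roots_Ψ₂Sq (h2 : (2 : K) ≠ 0) : V.Ψ₂Sq.roots.toFinset.card = 3 := by
  have h4 : (4 : K) ≠ 0 := by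
    rw [show (4 : K) = 2 * 2 by norm_num]; exact mul_ne_zero h2 h2
  have ha : V.twoTorsionPolynomial.a ≠ 0 := h4
  have hsplit : (V.twoTorsionPolynomial.toPoly.map (RingHom.id K)).Splits := IsAlgClosed.splits _
  have hdisc : V.twoTorsionPolynomial.discr ≠ 0 :=
    V.twoTorsionPolynomial_discr_ne_zero (isUnit_iff_ne_zero.mpr h2) V.isUnit_Δ
  have := Cubic.card_roots_of_discr_ne_zero ha hsplit hdisc
  rwa [Cubic.map_roots, Polynomial.map_id, ← Ψ₂Sq_eq] at this

/-- **`Φ₂` and `Ψ₂Sq` have no common root when `Δ ≠ 0`** (Silverman, *AEC*, Exercise 3.1, in the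
pointwise form needed here; `char K ≠ 2`): if `Ψ₂Sq(x₀) = 0` then
`Φ₂(x₀) = x₀⁴ - b₄x₀² - 2b₆x₀ - b₈ ≠ 0`. Indeed at a root `r₁` of `Ψ₂Sq` one has
`Φ₂(r₁) = (r₁ - r₂)²(r₁ - r₃)²` in terms of the other two roots. [cite: SilvermanAEC2009, Exercise 3.1] -/
theorem eval_Φ_two_ne_zero_of_isRoot_Ψ₂Sq (h2 : (2 : K) ≠ 0) {x₀ : K} (hx₀ : V.Ψ₂Sq.IsRoot x₀) :
    (V.Φ 2).eval x₀ ≠ 0 := by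
  have h4 : (4 : K) ≠ 0 := by
    rw [show (4 : K) = 2 * 2 by norm_num]; exact mul_ne_zero h2 h2
  obtain ⟨r₁, r₂, r₃, hroots, ⟨h12, h13, h23⟩, hb₂, hb₄, hb₆⟩ := V.exists_roots_Ψ₂Sq h2
  have hrel := V.b_relation
  -- the key identity, for a root `r` and the two other roots `s, t`
  have key : ∀ r s t : K, V.b₂ = 4 * -(r + s + t) → 2 * V.b₄ = 4 * (r * s + r * t + s * t) →
      V.b₆ = 4 * -(r * s * t) → (V.Φ 2).eval r = 0 → r = s ∨ r = t := by
    intro r s t hb₂ hb₄ hb₆ hΦ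
    have hb₄' : V.b₄ = 2 * (r * s + r * t + s * t) :=
      mul_left_cancel₀ h2 (by rw [hb₄]; ring)
    have hΦ' : r ^ 4 - V.b₄ * r ^ 2 - 2 * V.b₆ * r - V.b₈ = 0 := by
      rw [Φ_two] at hΦ
      simpa only [eval_sub, eval_pow, eval_X, eval_mul, eval_C] using hΦ
    have hT : 4 * ((r - s) ^ 2 * (r - t) ^ 2) = 0 := by
      have : 4 * (r ^ 4 - V.b₄ * r ^ 2 - 2 * V.b₆ * r - V.b₈) = 4 * ((r - s) ^ 2 * (r - t) ^ 2) := by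
        linear_combination (-V.b₆) * hb₂ + (V.b₄ + 2 * (r * s + r * t + s * t) - 4 * r ^ 2) * hb₄' +
          (-(8 * r) - 4 * -(r + s + t)) * hb₆ + (-1) * hrel
      rw [← this, hΦ', mul_zero]
    rcases mul_eq_zero.mp hT with h | h
    · exact (h4 h).elim
    · rcases mul_eq_zero.mp h with h | h
      · exact Or.inl (sub_eq_zero.mp (pow_eq_zero_iff two_ne_zero |>.mp h))
      · exact Or.inr (sub_eq_zero.mp (pow_eq_zero_iff two_ne_zero |>.mp h))
  intro hΦ
  have hmem : x₀ ∈ V.Ψ₂Sq.roots := (mem_roots (V.Ψ₂Sq_ne_zero h4)).mpr hx₀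
  rw [hroots] at hmem
  simp only [Multiset.insert_eq_cons, Multiset.mem_cons, Multiset.mem_singleton] at hmem
  rcases hmem with rfl | rfl | rfl
  · rcases key x₀ r₂ r₃ hb₂ hb₄ hb₆ hΦ with h | h
    · exact h12 h
    · exact h13 h
  · rcases key x₀ r₁ r₃ (by rw [hb₂]; ring) (by rw [hb₄]; ring) (by rw [hb₆]; ring) hΦ with h | h
    · exact h12 h.symm
    · exact h23 h
  · rcases key x₀ r₁ r₂ (by rw [hb₂]; ring) (by rw [hb₄]; ring) (by rw [hb₆]; ring) hΦ with h | h
    · exact h13 h.symm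
    · exact h23 h.symm

/-! ### `#E(K)[2] = 4` -/

/-- **`#E[2] = 4`** over an algebraically closed field `K` with `2 ≠ 0`: the `2`-torsion consists of
`O` and the three points `(rᵢ, -(a₁rᵢ + a₃)/2)`, `rᵢ` the (distinct) roots of
`Ψ₂Sq = 4x³ + b₂x² + 2b₄x + b₆`. Silverman, *AEC*, proof of Prop. III.4.2(a) and Exercise 3.31(c)
(`n = 1`); Cor. III.6.4(b) for `m = 2`. [cite: SilvermanAEC2009, Cor. III.6.4(b) (m = 2)] -/
theorem natCard_torsionBy_two (h2 : (2 : K) ≠ 0) :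
    Nat.card (V.toAffine.Point[((2 : ℕ) : ℤ)]) = 4 := by
  have h4 : (4 : K) ≠ 0 := by
    rw [show (4 : K) = 2 * 2 by norm_num]; exact mul_ne_zero h2 h2
  set S := V.Ψ₂Sq.roots.toFinset with hS
  have hS3 : S.card = 3 := V.card_roots_Ψ₂Sq h2
  have hmemS : ∀ {x₀ : K}, x₀ ∈ S ↔ V.Ψ₂Sq.IsRoot x₀ := fun {x₀} => by
    rw [hS, Multiset.mem_toFinset, mem_roots (V.Ψ₂Sq_ne_zero h4)]
  -- the unique point above a root `x₀` of `Ψ₂Sq`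
  let y₀ : K → K := fun x₀ => -(V.a₁ * x₀ + V.a₃) / 2
  have hy₀D : ∀ x₀, 2 * y₀ x₀ + V.a₁ * x₀ + V.a₃ = 0 := fun x₀ => by
    simp only [y₀]; field_simp; ring
  have heq : ∀ {x₀ : K}, V.Ψ₂Sq.IsRoot x₀ → V.toAffine.Equation x₀ (y₀ x₀) := by
    intro x₀ hx₀
    have hψ₂ : V.ψ₂.evalEval x₀ (y₀ x₀) = 0 := by
      rw [ψ₂, Affine.evalEval_polynomialY]; exact hy₀D x₀
    have e := congrArg (Polynomial.evalEval x₀ (y₀ x₀)) V.ψ₂_sq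
    simp only [evalEval_pow, evalEval_add, evalEval_mul, evalEval_C, hψ₂] at e
    have h4e : (4 : K[X][Y]).evalEval x₀ (y₀ x₀) = 4 := evalEval_natCast x₀ (y₀ x₀) 4
    rw [h4e, hx₀.eq_zero, zero_add, zero_pow two_ne_zero] at e
    exact (mul_eq_zero.mp e.symm).resolve_left h4
  have hns : ∀ {x₀ : K}, V.Ψ₂Sq.IsRoot x₀ → V.toAffine.Nonsingular x₀ (y₀ x₀) := fun hx =>
    Affine.equation_iff_nonsingular.mp (heq hx)
  have htors : ∀ {x₀ : K} (hx : V.Ψ₂Sq.IsRoot x₀),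
      (2 : ℕ) • (Affine.Point.some x₀ (y₀ x₀) (hns hx) : V.toAffine.Point) = 0 := fun hx =>
    (V.two_nsmul_some_eq_zero_iff_isRoot_Ψ₂Sq (hns hx)).mpr hx
  let g : Option S → V.toAffine.Point[((2 : ℕ) : ℤ)] := fun o =>
    match o with
    | none => 0
    | some x₀ => ⟨Affine.Point.some (x₀ : K) (y₀ x₀) (hns (hmemS.mp x₀.2)),
        AddSubgroup.torsionBy.nsmul_iff.mpr (htors (hmemS.mp x₀.2))⟩
  -- `g` has a left inverse "x-coordinate", hence is injective
  let π : V.toAffine.Point[((2 : ℕ) : ℤ)] → Option K := fun P =>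
    match (P : V.toAffine.Point) with
    | .zero => none
    | .some x _ _ => some x
  have hπg : ∀ o : Option S, π (g o) = Option.map (Subtype.val : S → K) o := by
    rintro (_ | x)
    · rfl
    · rfl
  have hg : Function.Bijective g := by
    constructor
    · intro o₁ o₂ h12
      apply Option.map_injective Subtype.val_injective
      have e1 := hπg o₁
      rw [h12, hπg o₂] at e1
      exact e1.symm
    · rintro ⟨P, hP⟩
      rcases P with _ | ⟨x₁, y₁, h₁⟩
      · exact ⟨none, rfl⟩
      · have h2P : (2 : ℕ) • (Affine.Point.some x₁ y₁ h₁ : V.toAffine.Point) = 0 :=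
          AddSubgroup.torsionBy.nsmul_iff.mp hP
        have hx₁ : V.Ψ₂Sq.IsRoot x₁ := (V.two_nsmul_some_eq_zero_iff_isRoot_Ψ₂Sq h₁).mp h2P
        have hy₁ : y₁ = y₀ x₁ := by
          have := (V.two_nsmul_some_eq_zero_iff_eq_negY h₁).mp h2P
          rw [Affine.negY] at this
          simp only [y₀]
          field_simp
          linear_combination this
        subst hy₁
        exact ⟨some ⟨x₁, hmemS.mpr hx₁⟩, rfl⟩
  rw [← Nat.card_eq_of_bijective g hg, Nat.card_eq_fintype_card, Fintype.card_option,
    ← Nat.card_eq_fintype_card, Nat.card_eq_finsetCard, hS3]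

/-! ### `[2]` is surjective on `E(K)` -/

/-- **Multiplication by `2` is surjective on `E(K)`** for `K` algebraically closed with `2 ≠ 0`
(Silverman, *AEC*, Exercise 3.31(a): "the doubling map has degree 4", with II.2.3 / III.4.10(a);
here directly): for `Q = (c, d)` pick a root `x₀` of the quartic `Φ₂ - c·Ψ₂Sq` and `y₀` above it;
`P = (x₀, y₀)` is not `2`-torsion (`Φ₂`, `Ψ₂Sq` have no common root, Exercise 3.1), so by the
duplication formula `x([2]P) = Φ₂(x₀)/Ψ₂Sq(x₀) = c` and `[2]P = ±Q`. [cite: SilvermanAEC2009, Exercise 3.31(a) with Group Law Algorithm III.2.3(d)] -/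
theorem two_nsmul_surjective_of_isAlgClosed (h2 : (2 : K) ≠ 0) :
    Function.Surjective fun P : V.toAffine.Point => (2 : ℕ) • P := by
  intro Q
  rcases Q with _ | ⟨c, d, hQ⟩
  · exact ⟨0, smul_zero _⟩
  · -- a root `x₀` of the quartic `Φ₂ - c Ψ₂Sq`
    set f : K[X] := V.Φ 2 - C c * V.Ψ₂Sq with hf
    have hΦdeg : (V.Φ 2).natDegree = 4 := by rw [natDegree_Φ]; norm_num
    have hlt : (C c * V.Ψ₂Sq).natDegree < (V.Φ 2).natDegree := by
      rw [hΦdeg]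
      refine lt_of_le_of_lt (natDegree_C_mul_le c _) ?_
      exact lt_of_le_of_lt V.natDegree_Ψ₂Sq_le (by norm_num)
    have hfdeg : f.natDegree = 4 := by rw [hf, natDegree_sub_eq_left_of_natDegree_lt hlt, hΦdeg]
    have hf0 : f ≠ 0 := fun h0 => by rw [h0, natDegree_zero] at hfdeg; exact four_ne_zero hfdeg.symm
    have hdeg : f.degree ≠ 0 := by
      rw [degree_eq_natDegree hf0, hfdeg]; simp
    obtain ⟨x₀, hx₀⟩ := IsAlgClosed.exists_root f hdeg
    obtain ⟨y₀, hy₀⟩ := V.exists_equation_of_isAlgClosed x₀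
    have hP : V.toAffine.Nonsingular x₀ y₀ := Affine.equation_iff_nonsingular.mp hy₀
    have hfx : (V.Φ 2).eval x₀ = c * V.Ψ₂Sq.eval x₀ := by
      have := hx₀.eq_zero
      rw [hf, eval_sub, eval_mul, eval_C] at this
      exact sub_eq_zero.mp this
    -- `Ψ₂Sq(x₀) ≠ 0`, i.e. `2P ≠ 0`
    have hΨ : V.Ψ₂Sq.eval x₀ ≠ 0 := fun h0 =>
      V.eval_Φ_two_ne_zero_of_isRoot_Ψ₂Sq h2 h0 (by rw [hfx, h0, mul_zero])
    have hy : y₀ ≠ V.toAffine.negY x₀ y₀ := fun hneg =>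
      hΨ ((V.two_nsmul_some_eq_zero_iff_isRoot_Ψ₂Sq hP).mp
        ((V.two_nsmul_some_eq_zero_iff_eq_negY hP).mpr hneg))
    have h2P : (2 : ℕ) • (Affine.Point.some x₀ y₀ hP : V.toAffine.Point) =
        Affine.Point.some _ _ (Affine.nonsingular_add hP hP fun hxy => hy hxy.right) := by
      rw [two_nsmul, Affine.Point.add_self_of_Y_ne hy]
    -- the `x`-coordinate of `2P` is `c`
    have hx : V.toAffine.addX x₀ x₀ (V.toAffine.slope x₀ x₀ y₀ y₀) = c := by
      have h1 := V.addX_self_mul_eval_Ψ₂Sq hy₀ hy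
      rw [hfx] at h1
      exact mul_right_cancel₀ hΨ h1
    rcases Affine.Y_eq_of_X_eq (Affine.nonsingular_add hP hP fun hxy => hy hxy.right).left hQ.left hx
      with hyd | hyd
    · refine ⟨Affine.Point.some x₀ y₀ hP, ?_⟩
      change (2 : ℕ) • (Affine.Point.some x₀ y₀ hP : V.toAffine.Point) = _
      rw [h2P]
      simp only [hx, hyd]
    · refine ⟨-Affine.Point.some x₀ y₀ hP, ?_⟩
      change (2 : ℕ) • (-(Affine.Point.some x₀ y₀ hP : V.toAffine.Point)) = _
      rw [smul_neg, h2P, Affine.Point.neg_some]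
      simp only [hx, hyd, Affine.negY_negY]

/-! ### `#E(K)[2ᵏ] = 4ᵏ` -/

/-- **`#E[2ᵏ] = 4ᵏ = 2^{2k}`** over an algebraically closed field with `2 ≠ 0`
(Silverman, *AEC*, Exercise 3.31(c); Cor. III.6.4(b) for `m = 2ᵏ`), from `#E[2] = 4` and the
surjectivity of `[2]`. [cite: SilvermanAEC2009, Exercise 3.31(c)] -/
theorem natCard_torsionBy_two_pow (h2 : (2 : K) ≠ 0) (k : ℕ) :
    Nat.card (V.toAffine.Point[((2 ^ k : ℕ) : ℤ)]) = 2 ^ (2 * k) := by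
  rw [pow_mul, show (2 : ℕ) ^ 2 = 4 by norm_num]
  exact Literature.NumberTheory.EllipticCurves.natCard_torsionBy_pow_of_nsmul_surjective (V.two_nsmul_surjective_of_isAlgClosed h2)
    (V.natCard_torsionBy_two h2) k

end TwoNeZero

/-! ## The `2`-adic Tate module of an elliptic curve over any field of characteristic `≠ 2` -/

section TateModule

open Literature.NumberTheory.EllipticCurves

variable {F : Type u} [Field F] (W : WeierstrassCurve F)

/-- For an elliptic curve `W` over a field `F` with `2 ≠ 0` in `F`, `#E(F̄)[2ᵏ] = 2^{2k}` for all `k`.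
Silverman, *AEC*, Exercise 3.31(c) / Cor. III.6.4(b) (`m = 2ᵏ`). [cite: SilvermanAEC2009, Exercise 3.31(c)] -/
theorem card_geomTorsion_two_pow [W.IsElliptic] (h2 : (2 : F) ≠ 0) (k : ℕ) :
    Nat.card (geomTorsion W (2 ^ k : ℕ)) = 2 ^ (2 * k) := by
  have h2' : (2 : AlgebraicClosure F) ≠ 0 := fun h0 => h2 <| by
    apply (algebraMap F (AlgebraicClosure F)).injective
    rw [map_ofNat, map_zero, h0]
  haveI : (W.baseChange (AlgebraicClosure F)).IsElliptic :=
    inferInstanceAs (W.map (algebraMap F (AlgebraicClosure F))).IsElliptic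
  exact (W.baseChange (AlgebraicClosure F)).natCard_torsionBy_two_pow h2' k

/-- **Silverman, *AEC*, Prop. III.7.1(a) at `ℓ = 2`, unconditionally**: for an elliptic curve over a
field of characteristic `≠ 2`, `rank_{ℤ₂} T₂(E) = 2`; i.e. the named fact
`finrank_tateModule_eq_two W 2` holds. [cite: SilvermanAEC2009, Prop. III.7.1(a)] -/
theorem finrank_tateModule_eq_two_holds_two : finrank_tateModule_eq_two W 2 := by
  intro _ hp
  exact TateModule.finrank_eq_two_of_card_torsionBy
    (card_geomTorsion_two_pow W (by exact_mod_cast hp))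

/-- **Silverman, *AEC*, Prop. III.7.1(a) with Remark 7.2 at `ℓ = 2`, unconditionally**: for an
elliptic curve over a field of characteristic `≠ 2`, `dim_{ℚ₂} V₂(E) = 2`; i.e. the named fact
`finrank_rationalTateModule_eq_two W 2` holds. [cite: SilvermanAEC2009, Prop. III.7.1(a) with Remark 7.2] -/
theorem finrank_rationalTateModule_eq_two_holds_two : finrank_rationalTateModule_eq_two W 2 := by
  intro _ hp
  exact RationalTateModule.finrank_eq_two_of_card_torsionBy
    (card_geomTorsion_two_pow W (by exact_mod_cast hp))

/-- `T₂(E)` is a free `ℤ₂`-module for an elliptic curve over a field of characteristic `≠ 2`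
(Silverman, *AEC*, Prop. III.7.1(a) at `ℓ = 2`). [cite: SilvermanAEC2009, Prop. III.7.1(a)] -/
theorem free_tateModule_two [W.IsElliptic] (h2 : (2 : F) ≠ 0) : Module.Free ℤ_[2] (W.tateModule 2) :=
  TateModule.free_of_card_torsionBy (card_geomTorsion_two_pow W h2)

/-- `T₂(E)` is a finitely generated `ℤ₂`-module for an elliptic curve over a field of
characteristic `≠ 2` (Silverman, *AEC*, Prop. III.7.1(a) at `ℓ = 2`). [cite: SilvermanAEC2009, Prop. III.7.1(a)] -/
theorem finite_tateModule_two [W.IsElliptic] (h2 : (2 : F) ≠ 0) :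
    Module.Finite ℤ_[2] (W.tateModule 2) :=
  TateModule.finite_of_card_torsionBy (card_geomTorsion_two_pow W h2)

/-- `V₂(E)` is finite-dimensional over `ℚ₂` for an elliptic curve over a field of characteristic
`≠ 2` (Silverman, *AEC*, Prop. III.7.1(a) with Remark 7.2 at `ℓ = 2`). [cite: SilvermanAEC2009, Prop. III.7.1(a) with Remark 7.2] -/
theorem finite_rationalTateModule_two [W.IsElliptic] (h2 : (2 : F) ≠ 0) :
    Module.Finite ℚ_[2] (W.rationalTateModule 2) :=
  RationalTateModule.finite_of_card_torsionBy (card_geomTorsion_two_pow W h2)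

end TateModule

end WeierstrassCurve
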